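import Summits.BirchSwinnertonDyer.Rank1Residual.Additive.PinnedKatoGenusFrameOfRecordLin
import Summits.BirchSwinnertonDyer.Rank1Residual.Additive.RamifiedSevenGenusPartnerIsogenyPairRat
import HarnessLib

set_option autoImplicit false

/-!
# `𝒞₇` genus road (crux `EllipticUnitValueSevenOfGZK`, K7r), (J-a)(2): the Kummer column record CARRYING ITS `ℚ`-ISOGENY PAIR
# (`KummerColumnDataRat`), its constructor from `h159″`, its selector, and the transport pins it feeds

Cell bsd-cm, seat bsd-cm-k-ty1 g35 (literature-prover; explicit unit, claim-free); pen bsd-cm-plan g39 D1135 (J-a)(2), D1137, D1140/D1141;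
critic idea-crit-15 g18 NOTE #18 (B) («the record forgets `ℚ`-rationality»), NOTE #21.  Pattern = FILE 3 `PinnedKatoGenusFrameOfRecordLin.lean`
(p822298); nothing landed is touched (a NEW record extending the old one, a NEW ∃-package with ONE `obtain` changed).

WHY.  `KummerColumnData` (p818949) keeps the partner `W₂`, `IsIsogenous W W₂` (no degree) and a `Kcm`-pair `(α, β, e)`, `β ∘ α = [e]`,
`e ∈ {1, 2}` — while its source `EllipticUnitColumn.exists_partner_isogenyPair` BUILDS that pair as `(ψ₀.extendScalars Kcm, φ₀.extendScalars Kcm)`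
from a `ℚ`-isogeny `φ₀ : W → W₂` of degree `e` and its dual `ψ₀`, then forgets `φ₀, ψ₀` under `∃`.  The (S-D-★′) road (F-P1 ∀-eliminated at
the partner, D1128/D1135) transports the `ℚ`-side pin along `φ₀` (`PartnerTransport.transportQ`, p823222), the `K`-side pin along
`β = φ₀.extendScalars Kcm` (`PartnerTransport.transport`) and compares restrictions by `resOver_transportQ_transport` (p823364), which needs
the `K`-pair to BE the base change of the `ℚ`-pair; an ARBITRARY record (the stub ∀-binds `D₃`) does not remember `φ₀` (twist partners admit
no prime-to-`7` `ℚ`-isogeny), so the record must CARRY the pair ((J-a), D1135/D1137).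

CONTENTS.  §1 `KummerColumnLin.exists_kummerColumn_withPsiK_rat` — `exists_kummerColumn_withPsiK_lin` (p822076) RE-ISSUED with the `ℚ`-pair
KEPT (`φ₀, ψ₀, e, u`, `ψ₀ ∘ φ₀ = [e]`, `φ₀ ∘ ψ₀ = [e]`, `e ∈ {1,2}`, `u = e ∈ ℤ_7ˣ`, both `Kcm`-composites `= [e]`), every later datum on the pair
`(ψ₀.extendScalars Kcm, φ₀.extendScalars Kcm)`; body = the landed body token for token, top `obtain` from
`PartnerTransport.exists_partner_isogenyPairRat_extendScalars` (p823574).  §2 `structure KummerColumnDataRat … extends KummerColumnDataLin …`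
(fields `φ₀, ψ₀, α_eq, β_eq, ψφ, φψ, u, u_eq`), the derived `αβ : α ∘ β = [e]` (the `hαβ` input of `transport` the old record lacks),
`nonempty_kummerColumnDataRat (h159″) …` with the binders of `nonempty_kummerColumnDataLin` VERBATIM.  §3 the selector `kummerColumnDataRatOf`,
SAME explicit argument list as `kummerColumnDataLinOf` (`h159'' hE h25 h24i hM1 hM1' hG hC K hK F hbad Kcm h2 s hs c hc ι₀ hι₀ γK IK φ hφ`).
§4 the pins FED BY THE RECORD: `D.transportIK IK′ := transport IK′ D.β D.α D.e D.u …`, `D.transportI I := transportQ I D.φ₀ D.ψ₀ D.e D.u …`,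
their `proj` (`rfl`), and ★ (T4) on the nose `D.resOver_transportI_transportIK : (D.transportI I).resOver (D.transportIK IK′) hγ hγK y =
I.resOver IK′ hγ hγK y` (through `α_eq`/`β_eq` by `subst` on the variable-form `PartnerTransport.resOver_transportQ_transport_of_eq`).

HONEST LABEL: a record extension (our own bookkeeping made honest), one re-issued ∃-package (body copied from p822076 with one `obtain`
changed), one constructor, one selector, two pin abbreviations and three `rfl`/transport lemmas; kernel theorems conditional on the
displayed EXISTING named facts `h159″, hE, h25, h24i, hM1, hM1′, hG` exactly as the landed column; 0 new named facts, no `sorry`, no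
`instance` declaration, no notation, no attribute removed.  Nothing about Kato's VALUES, a defined `exp*`, (S-D-★′), (S-★′) or the
orientation of `√−7` is proved; no stub of the line of record (zp v20 `kato_perrin_riou_zp` a4ba175e5009387e, 5 sorries) closes;
stmt-BirchSwinnertonDyer-19945 stays OPEN; `X12.CMRamifiedSeven` is NOT proved; no summit statement is proved by this seat; BSD is
claimed for no curve.

## References
* K. Kato, *p-adic Hodge theory and values of zeta functions of modular forms*, Astérisque 295 (2004), §12.2 (p. 220), Ex. 13.3 (p. 225),
  (15.6.1) (p. 253), §15.7 (pp. 255–256), Prop. 15.9 / (15.9.1) (pp. 258–259), (15.12.1) (p. 263), 15.14 (p. 264). [Kato2004Asterisque]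
* J. H. Silverman, *The Arithmetic of Elliptic Curves*, 2nd ed. (2009), III §4 (p. 66), Thm. III.6.1 (a), Thm. III.6.2 (a). [SilvermanAEC2009]
* J. H. Silverman, *Advanced Topics in the Arithmetic of Elliptic Curves* (1994), II Prop. 10.4 (p. 170), Cor. 10.4.1 (a) (p. 171). [SilvermanATAEC1994]
* K. Rubin, *Euler Systems* (2000), App. B §3. [Rubin2000]
* S. Bloch, K. Kato (1990), Def. 3.10 and Ex. 3.11 (p. 361). [BlochKato1990]   D. A. Cox (2013), §5.B (5.13). [Cox2013]
* Tree: p818949 `…KummerColumnData`, p822076 `…KummerColumnLin`, p822298 `PinnedKatoGenusFrameOfRecordLin`, p823222/p823364/p823574 `…PartnerTransport{,Res}`, `…PartnerIsogenyPairRat`.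
-/

noncomputable section

open scoped NumberField TensorProduct
open WeierstrassCurve Field NumberField IsDedekindDomain
open Literature.NumberTheory.IwasawaTheory
open Literature.NumberTheory.GaloisRepresentations Literature.NumberTheory.GaloisRepresentations.LocalWeilDatum
open Literature.NumberTheory.EllipticCurves
open Literature.NumberTheory.EllipticCurves.Rank1Residual
open Literature.NumberTheory.EllipticCurves.IwasawaAlgebra
open Literature.NumberTheory.EllipticCurves.Kato2004
open Literature.NumberTheory.ComplexMultiplication.EllipticUnits
open Summit.BirchSwinnertonDyer.Rank1Residual
open Summit.BirchSwinnertonDyer.Rank1Residual.Additive.GenusSeven.EllipticUnitColumn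
open Summit.BirchSwinnertonDyer.Rank1Residual.Additive.GenusSeven.KummerUnitTower

namespace Summit.BirchSwinnertonDyer.Rank1Residual.Additive.GenusSeven

namespace KummerColumnLin

/-! ## §1 The (H_e) + (psiK) + (lin) Kummer column ∃-package WITH ITS `ℚ`-ISOGENY PAIR KEPT -/

/-- ★ **THE KUMMER COLUMN WITH (H_e), (psiK) AND (lin), FROM `h159″`, WITH THE `ℚ`-PAIR KEPT.**  `exists_kummerColumn_withPsiK_lin` (p822076)
re-issued: the partner `W₂` (`j = −3375`), `ℚ`-ISOGENIES `φ₀ : W → W₂`, `ψ₀ : W₂ → W` with `ψ₀ ∘ φ₀ = [e]`, `φ₀ ∘ ψ₀ = [e]`, `e ∈ {1, 2}`, the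
`7`-adic unit `u = e`, both `Kcm`-composites of `(ψ₀.extendScalars Kcm, φ₀.extendScalars Kcm)` `= [e]`, a GOOD `γ₂`, the Deuring `ψ` of `W₂` WITH
GENERATORS and its three letters, (psiK), `Ω ≠ 0`, `𝔏` with (lin), `euK` and the per-twist package — all on `(α, β) := (ψ₀.ext, φ₀.ext)`.  Proof:
the landed body token for token, top `obtain` from `PartnerTransport.exists_partner_isogenyPairRat_extendScalars` (`IsIsogenous W W₂ := ⟨φ₀⟩`).
Conditional on `h159″, hE, h25, h24i, hM1, hM1′, hG`.  [cite: Kato2004Asterisque, (15.6.1) (p. 253), §15.7 (pp. 255–256), Prop. 15.9 and (15.9.1)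
(pp. 258–259), 15.14 (p. 264)] [cite: SilvermanAEC2009, III §4 (p. 66), Thm. III.6.1 (a), Thm. III.6.2 (a)] [cite: SilvermanATAEC1994, Ch. II
Prop. 10.4 (p. 170), Cor. 10.4.1 (a) (p. 171)] [cite: Cox2013, §5.B (5.13)] -/
theorem exists_kummerColumn_withPsiK_rat (h159'' : CM.prop159_kummerCup_expStar_values_linear)
    (hE : Literature.NumberTheory.ComplexMultiplication.EllipticUnits.Kato2004.sec155_exists_katoUnitRep)
    (h25 : DeShalit1987.prop25_i_normRelation) (h24i : DeShalit1987.prop24_i_mem_rayClassField)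
    (hM1 : CM.rayClassField_le_torsionField) (hM1' : CM.torsionField_le_rayClassField_of_conductor)
    (hG : Gross_conductorExponent_baseChange_eq_two_mul)
    {W : WeierstrassCurve ℚ} [W.IsElliptic] [W.IsGloballyMinimal] [Fact (Nat.Prime 7)] (hC : X12.ClassCSeven W) {d : ℕ}
    (hbad : ∀ (q : ℕ) [Fact q.Prime], q ≠ 7 → (¬ Good W q ↔ q ∣ d)) (hodd : Odd d)
    (Kcm : Type) [Field Kcm] [NumberField Kcm] (h2 : Module.finrank ℚ Kcm = 2) (s : Kcm) (hs : s ^ 2 = -7)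
    (c : Kcm ≃ₐ[ℚ] Kcm) (hc : c ≠ 1) (ι₀ : Kcm →+* ℂ) (hι₀ : ∀ (w : InfinitePlace Kcm) (x : Kcm), ι₀ x = w.embedding x)
    [ContinuousSMul ℤ_[7] ((W.baseChange Kcm).tateModule 7)]
    (K : ZpExtension ℚ 7) (hK : K.IsCyclotomic) {γK : absoluteGaloisGroup Kcm}
    (IK : IwasawaH1DataOver (W.baseChange Kcm) 7 (K.restrictOfFinrankEqTwo (by decide) Kcm h2) γK)
    (𝔣 : Ideal (𝓞 Kcm)) (h𝔣N : Ideal.absNorm 𝔣 = 7 * d ^ 2) (h𝔣dvd : 𝔣 ∣ Ideal.span {((7 * d : ℕ) : 𝓞 Kcm)})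
    (φ : Isogeny (W.baseChange Kcm) (W.baseChange Kcm)) (hφ : ∀ P, φ (φ P) = (-7 : ℤ) • P) :
    ∃ (W₂ : WeierstrassCurve ℚ) (_ : W₂.IsElliptic) (_ : W₂.IsGloballyMinimal)
      (_ : ContinuousSMul ℤ_[7] ((W₂.baseChange Kcm).tateModule 7))
      (φ₀ : Isogeny W W₂) (ψ₀ : Isogeny W₂ W) (e : ℤ) (u : ℤ_[7]ˣ)
      (γ₂ : (W₂.baseChange Kcm).tateModule 7) (hf : 0 < 7 * d)
      (ψ : HeckeCharacter Kcm) (Ω : ℂ)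
      (𝔏 : ∀ U : Subgroup (absoluteGaloisGroup Kcm),
        H1 (CM.tateRepK (W.baseChange Kcm) 7) U →ₗ[ℤ_[7]] ℚ_[7] ⊗[ℤ] AlgebraicClosure Kcm)
      (euK : Ideal (𝓞 Kcm) → IK.H),
      W₂.j = -3375 ∧ (∀ P, ψ₀ (φ₀ P) = e • P) ∧ (∀ Q, φ₀ (ψ₀ Q) = e • Q) ∧ (e = 1 ∨ e = 2) ∧ (u : ℤ_[7]) = e ∧
      (∀ P, ψ₀.extendScalars Kcm (φ₀.extendScalars Kcm P) = e • P) ∧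
      (∀ Q, φ₀.extendScalars Kcm (ψ₀.extendScalars Kcm Q) = e • Q) ∧
      φ (ψ₀.extendScalars Kcm (((KummerFrame.ofTorsionTower (W₂.baseChange Kcm) 7 (7 * d) hf γ₂).e 1 :
        geomTorsion (W₂.baseChange Kcm) ((7 : ℤ) ^ 1)) : geomPoints (W₂.baseChange Kcm))) ≠ 0 ∧
      ψ.HasInfinityType (fun _ ↦ 1) (fun _ ↦ 0) ∧
      (∀ z : ℂ, 3 / 2 < z.re → heckeLFunction ψ z = W.LSeries z) ∧
      (∀ a : 𝓞 Kcm, a ≠ 0 → ((7 * d : ℕ) : 𝓞 Kcm) ∣ a - 1 →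
        CM.heckeCharIdealValue ψ (Ideal.span {a}) = algClosureEmb ι₀ (algebraMap Kcm (AlgebraicClosure Kcm) (a : Kcm))) ∧
      (∀ μ : Kcm, μ ^ 2 = -7 → ∃ b₀ b₁ : Ideal (𝓞 Kcm) → ℤ, ∀ 𝔟 : Ideal (𝓞 Kcm), IsTwist 7 𝔣 𝔟 →
        2 * CM.heckeCharIdealValue ψ 𝔟 = (b₀ 𝔟 : ℂ) + (b₁ 𝔟 : ℂ) * ι₀ μ) ∧
      Ω ≠ 0 ∧
      (∀ (φ' : Isogeny (W.baseChange Kcm) (W.baseChange Kcm)) (m : ℤ), (∀ P, φ' (φ' P) = m • P) →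
        ∃ μ : Kcm, μ ^ 2 = (m : Kcm) ∧
          ∀ (n : ℕ) (c : H1 (CM.tateRepK (W.baseChange Kcm) 7) (CM.torsionLayer (W.baseChange Kcm) (7 ^ n * (7 * d)))),
            𝔏 (CM.torsionLayer (W.baseChange Kcm) (7 ^ n * (7 * d)))
                (isogenyLayerMapK 7 φ' (CM.torsionLayer (W.baseChange Kcm) (7 ^ n * (7 * d))) c) =
              ((1 : ℚ_[7]) ⊗ₜ[ℤ] algebraMap Kcm (AlgebraicClosure Kcm) μ) *
                𝔏 (CM.torsionLayer (W.baseChange Kcm) (7 ^ n * (7 * d))) c) ∧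
      ∀ 𝔟 : Ideal (𝓞 Kcm), IsTwist 7 𝔣 𝔟 →
        ∃ u : (KummerFrame.ofTorsionTower (W₂.baseChange Kcm) 7 (7 * d) hf γ₂).UnitTower,
          (∀ n : ℕ, 1 ≤ n → CM.IsKatoUnitRepAt 7 (algClosureEmb ι₀) (Ideal.span {((7 * d : ℕ) : 𝓞 Kcm)}) n 𝔟 (u.z n)) ∧
          (∃ y : Subgroup (absoluteGaloisGroup Kcm) → AlgebraicClosure Kcm,
            CM.EllipticZetaBody Kcm (W.baseChange Kcm) 7 ψ (7 * d) (algClosureEmb ι₀) Ω 𝔏 𝔟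
              (fun U ↦ isogenyLayerMapK 7 (ψ₀.extendScalars Kcm) U
                ((KummerFrame.ofTorsionTower (W₂.baseChange Kcm) 7 (7 * d) hf γ₂).tateClass u U)) y) ∧
          ∀ n : ℕ, IK.proj n (euK 𝔟) = isogenyLayerMapK 7 (ψ₀.extendScalars Kcm) _
            ((KummerFrame.ofTorsionTower (W₂.baseChange Kcm) 7 (7 * d) hf γ₂).tateClass u
              ((K.restrictOfFinrankEqTwo (by decide) Kcm h2).layerSubgroup n)) := by
  -- the maximal-order partner and the isogeny pair OVER `ℚ`, with its `7`-adic unit and the `Kcm`-bridge ((J-a)(1), p823574)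
  obtain ⟨W₂, hW₂, hmin, φ₀, ψ₀, e, u, hjW₂, hψφ, hφψ, he, hu, hαβ, hβα⟩ :=
    PartnerTransport.exists_partner_isogenyPairRat_extendScalars hC.2.1 Kcm
  haveI := hW₂; haveI := hmin; haveI : ContinuousSMul ℤ_[7] ((W₂.baseChange Kcm).tateModule 7) := TateModule.continuousSMul_padicInt
  have hiso : IsIsogenous W W₂ := ⟨φ₀⟩
  have hd0 : d ≠ 0 := by
    rintro rfl
    exact (Nat.not_odd_iff_even.mpr (by decide)) hodd
  have hf : 0 < 7 * d := by omega
  -- a GOOD `γ₂`: `φ (α (γ₂ mod 7)) ≠ 0` for `α := ψ₀.extendScalars Kcm`, `β := φ₀.extendScalars Kcm`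
  obtain ⟨γ₂, hγ₂⟩ :=
    KummerColumnGoodGamma.exists_tateModule_good (ψ₀.extendScalars Kcm) (φ₀.extendScalars Kcm) hβα he φ hφ
  have he₁ : φ (ψ₀.extendScalars Kcm (((KummerFrame.ofTorsionTower (W₂.baseChange Kcm) 7 (7 * d) hf γ₂).e 1 :
      geomTorsion (W₂.baseChange Kcm) ((7 : ℤ) ^ 1)) : geomPoints (W₂.baseChange Kcm))) ≠ 0 := by
    rw [KummerFrame.ofTorsionTower_e]
    exact hγ₂
  have he₂ : ∃ k, (KummerFrame.ofTorsionTower (W₂.baseChange Kcm) 7 (7 * d) hf γ₂).e k ≠ 0 := by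
    refine ⟨1, fun h0 ↦ he₁ ?_⟩
    rw [h0, ZeroMemClass.coe_zero, map_zero, map_zero]
  -- the Deuring Grössencharacter of `W₂` WITH GENERATORS
  have hmax : W₂.j ∈ maximalCMJInvariants := by
    rw [hjW₂]
    simp [maximalCMJInvariants]
  have hKj : IsCMFieldOfJ Kcm W₂.j := by
    rw [hjW₂]
    exact MemberGrossencharacter.isCMFieldOfJ_neg3375 Kcm h2 s hs
  obtain ⟨ψ, hψ, heq, hunr, -, hL₂, hgen⟩ :=
    Summit.BirchSwinnertonDyer.BirchSwinnertonDyer.Theorems.BiquadraticEisensteinDescentDeuringOfCore.Deuring_exists_heckeCharacter_of_maximalCM_withGenerators_holds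
      W₂ hmax Kcm hKj c hc
  have hLW : ∀ z : ℂ, 3 / 2 < z.re → heckeLFunction ψ z = W.LSeries z := fun z hz ↦ by
    rw [hL₂ z hz, IsIsogenous.LSeries_eq hiso]
  have hιC : ∀ (w : InfinitePlace Kcm) (x : Kcm), algClosureEmb ι₀ (algebraMap Kcm (AlgebraicClosure Kcm) x) = w.embedding x :=
    fun w x ↦ by rw [algClosureEmb_algebraMap, hι₀ w x]
  have hψf : ∀ a : 𝓞 Kcm, a ≠ 0 → ((7 * d : ℕ) : 𝓞 Kcm) ∣ a - 1 →
      CM.heckeCharIdealValue ψ (Ideal.span {a}) = algClosureEmb ι₀ (algebraMap Kcm (AlgebraicClosure Kcm) (a : Kcm)) :=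
    ConductorOfMember.heckeCharIdealValue_span_eq_of_deuring_member hG hC hbad Kcm h2 s hs hc hiso hjW₂ hψ heq hunr hL₂
      (algClosureEmb ι₀) hιC
  -- (psiK) from the generators, the ramification support being `(42)·𝔣`
  have hram : ∀ w : HeightOneSpectrum (𝓞 Kcm), ¬ ψ.IsUnramifiedAt w → katoModulus6 7 𝔣 ≤ w.asIdeal :=
    KummerColumnOfPsi.katoModulus6_le_of_not_isUnramifiedAt hC hbad hd0 hiso h2 h𝔣N ⟨_, (Classical.choose_spec h𝔣dvd)⟩ hunr
  have hpsiK : ∀ μ : Kcm, μ ^ 2 = -7 → ∃ b₀ b₁ : Ideal (𝓞 Kcm) → ℤ, ∀ 𝔟 : Ideal (𝓞 Kcm), IsTwist 7 𝔣 𝔟 →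
      2 * CM.heckeCharIdealValue ψ 𝔟 = (b₀ 𝔟 : ℂ) + (b₁ 𝔟 : ℂ) * ι₀ μ := fun μ hμ ↦
    DeuringIdealValues.exists_coeffs_two_mul_heckeCharIdealValue_of_isTwist h2 hμ ι₀ ψ hgen hram
  -- the column on this `ψ`, from `h159″`, with (lin)
  obtain ⟨Ω, 𝔏, euK, hΩ, hlin, hcol⟩ := exists_kummerColumn_of_psi_lin h159'' hE h25 h24i hM1 hM1' hodd Kcm h2 s hs ι₀ hι₀ K hK IK 𝔣
    h𝔣N h𝔣dvd hjW₂ hiso (ψ₀.extendScalars Kcm) (φ₀.extendScalars Kcm) e hβα he γ₂ hf he₂ hψ hLW hψf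
  exact ⟨W₂, hW₂, hmin, inferInstance, φ₀, ψ₀, e, u, γ₂, hf, ψ, Ω, 𝔏, euK, hjW₂, hψφ, hφψ, he, hu, hαβ, hβα, he₁, hψ, hLW, hψf,
    hpsiK, hΩ, hlin, hcol⟩

end KummerColumnLin

/-! ## §2 The Kummer column record WITH (psiK), (lin) AND ITS `ℚ`-ISOGENY PAIR, as an extension -/

/-- **`KummerColumnDataRat` — the Kummer elliptic-unit column record of a member TOGETHER WITH (psiK), (lin) AND THE `ℚ`-ISOGENY PAIR its
`Kcm`-pair comes from** (pen D1135 (J-a)(2)): `KummerColumnDataLin` extended by `ℚ`-isogenies `φ₀ : W → W₂`, `ψ₀ : W₂ → W` with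
`α = ψ₀.extendScalars Kcm`, `β = φ₀.extendScalars Kcm` (`α_eq`, `β_eq`), `ψ₀ ∘ φ₀ = [e]` on `W(ℚ̄)`, `φ₀ ∘ ψ₀ = [e]` on `W₂(ℚ̄)`, and the
`7`-adic unit `u = e` — exactly the inputs of `PartnerTransport.transportQ` / `transport` / `resOver_transportQ_transport` (prime-to-`7`
pair).  A record of PROVED data (inhabited by `kummerColumnDataRatOf`); no field is a named fact.
[cite: SilvermanAEC2009, III §4 (p. 66), Thm. III.6.1 (a) and Thm. III.6.2 (a)] [cite: Kato2004Asterisque, §12.2 (p. 220), (15.6.1) (p. 253)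
and 15.14 (p. 264)] -/
structure KummerColumnDataRat (W : WeierstrassCurve ℚ) [W.IsElliptic] [Fact (Nat.Prime 7)]
    (Kcm : Type) [Field Kcm] [NumberField Kcm] (h2 : Module.finrank ℚ Kcm = 2)
    [ContinuousSMul ℤ_[7] ((W.baseChange Kcm).tateModule 7)]
    (K : ZpExtension ℚ 7) {γK : absoluteGaloisGroup Kcm}
    (IK : IwasawaH1DataOver (W.baseChange Kcm) 7 (K.restrictOfFinrankEqTwo (by decide) Kcm h2) γK)
    (ι₀ : Kcm →+* ℂ) (𝔣 : Ideal (𝓞 Kcm)) (d : ℕ)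
    (φ : Isogeny (W.baseChange Kcm) (W.baseChange Kcm)) extends KummerColumnDataLin W Kcm h2 K IK ι₀ 𝔣 d φ where
  /-- The `ℚ`-isogeny to the partner (degree `e`) and its dual over `ℚ`. -/
  φ₀ : Isogeny W W₂
  ψ₀ : Isogeny W₂ W
  /-- The record's `α : W₂_K → W_K`, `β : W_K → W₂_K` ARE the base changes of `ψ₀`, `φ₀`. -/
  α_eq : α = ψ₀.extendScalars Kcm
  β_eq : β = φ₀.extendScalars Kcm
  /-- `ψ₀ ∘ φ₀ = [e]` on `W(ℚ̄)`, `φ₀ ∘ ψ₀ = [e]` on `W₂(ℚ̄)`. -/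
  ψφ : ∀ P, ψ₀ (φ₀ P) = e • P
  φψ : ∀ Q, φ₀ (ψ₀ Q) = e • Q
  /-- The `7`-adic unit `u = e`. -/
  u : ℤ_[7]ˣ
  u_eq : (u : ℤ_[7]) = e

namespace KummerColumnDataRat

variable {W : WeierstrassCurve ℚ} [W.IsElliptic] [Fact (Nat.Prime 7)]
  {Kcm : Type} [Field Kcm] [NumberField Kcm] {h2 : Module.finrank ℚ Kcm = 2}
  [ContinuousSMul ℤ_[7] ((W.baseChange Kcm).tateModule 7)]
  {K : ZpExtension ℚ 7} {γK : absoluteGaloisGroup Kcm}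
  {IK : IwasawaH1DataOver (W.baseChange Kcm) 7 (K.restrictOfFinrankEqTwo (by decide) Kcm h2) γK}
  {ι₀ : Kcm →+* ℂ} {𝔣 : Ideal (𝓞 Kcm)} {d : ℕ}
  {φ : Isogeny (W.baseChange Kcm) (W.baseChange Kcm)}
  (D : KummerColumnDataRat W Kcm h2 K IK ι₀ 𝔣 d φ)

/-- `α ∘ β = [e]` on `W(K̄)` for the record's `Kcm`-pair (from `ψ₀ ∘ φ₀ = [e]` by base change; the `hαβ` input of
`PartnerTransport.transport`). [cite: SilvermanAEC2009, Thm. III.6.1 (a) and III §4 (p. 66)] -/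
theorem αβ : ∀ P, D.α (D.β P) = D.e • P := by
  rw [D.α_eq, D.β_eq]
  exact PartnerTransport.extendScalars_extendScalars_eq_zsmul Kcm D.φ₀ D.ψ₀ D.ψφ

/-- `ψ₀_K ∘ φ₀_K = [e]` on `W(K̄)` (base change of `ψφ`). [cite: SilvermanAEC2009, Thm. III.6.1 (a) and III §4 (p. 66)] -/
theorem ψφ_extendScalars : ∀ P, D.ψ₀.extendScalars Kcm (D.φ₀.extendScalars Kcm P) = D.e • P :=
  PartnerTransport.extendScalars_extendScalars_eq_zsmul Kcm D.φ₀ D.ψ₀ D.ψφ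

/-- `φ₀_K ∘ ψ₀_K = [e]` on `W₂(K̄)` (base change of `φψ`). [cite: SilvermanAEC2009, Thm. III.6.2 (a) and III §4 (p. 66)] -/
theorem φψ_extendScalars : ∀ Q, D.φ₀.extendScalars Kcm (D.ψ₀.extendScalars Kcm Q) = D.e • Q :=
  PartnerTransport.extendScalars_extendScalars_eq_zsmul Kcm D.ψ₀ D.φ₀ D.φψ

end KummerColumnDataRat

/-- **The thrice-extended record is inhabited** for `W ∈ 𝒞₇`, from `h159″` DIRECTLY: `KummerColumnLin.exists_kummerColumn_withPsiK_rat`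
gives the column on the base-changed `ℚ`-pair with the general (Z3c) clause on `W_K`, Skolemised at `(φ′, m) := (φ, −7)`.  Binders =
those of `nonempty_kummerColumnDataLin` VERBATIM (conditional on `h159″, hE, h25, h24i, hM1, hM1′, hG`; no further displayed hypothesis).
[cite: Kato2004Asterisque, (15.6.1) (p. 253), Prop. 15.9 (pp. 258–259), 15.14 (p. 264)] [cite: SilvermanAEC2009, Thm. III.6.1 (a), Thm. III.6.2 (a)]
[cite: SilvermanATAEC1994, Ch. II Cor. 10.4.1 (a) (p. 171)] -/
theorem nonempty_kummerColumnDataRat (h159'' : CM.prop159_kummerCup_expStar_values_linear)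
    (hE : Literature.NumberTheory.ComplexMultiplication.EllipticUnits.Kato2004.sec155_exists_katoUnitRep)
    (h25 : DeShalit1987.prop25_i_normRelation) (h24i : DeShalit1987.prop24_i_mem_rayClassField)
    (hM1 : CM.rayClassField_le_torsionField) (hM1' : CM.torsionField_le_rayClassField_of_conductor)
    (hG : Gross_conductorExponent_baseChange_eq_two_mul)
    {W : WeierstrassCurve ℚ} [W.IsElliptic] [W.IsGloballyMinimal] [Fact (Nat.Prime 7)] (hC : X12.ClassCSeven W) {d : ℕ}
    (hbad : ∀ (q : ℕ) [Fact q.Prime], q ≠ 7 → (¬ Good W q ↔ q ∣ d)) (hodd : Odd d)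
    (Kcm : Type) [Field Kcm] [NumberField Kcm] (h2 : Module.finrank ℚ Kcm = 2) (s : Kcm) (hs : s ^ 2 = -7)
    (c : Kcm ≃ₐ[ℚ] Kcm) (hc : c ≠ 1) (ι₀ : Kcm →+* ℂ) (hι₀ : ∀ (w : InfinitePlace Kcm) (x : Kcm), ι₀ x = w.embedding x)
    [ContinuousSMul ℤ_[7] ((W.baseChange Kcm).tateModule 7)]
    (K : ZpExtension ℚ 7) (hK : K.IsCyclotomic) {γK : absoluteGaloisGroup Kcm}
    (IK : IwasawaH1DataOver (W.baseChange Kcm) 7 (K.restrictOfFinrankEqTwo (by decide) Kcm h2) γK)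
    (𝔣 : Ideal (𝓞 Kcm)) (h𝔣N : Ideal.absNorm 𝔣 = 7 * d ^ 2) (h𝔣dvd : 𝔣 ∣ Ideal.span {((7 * d : ℕ) : 𝓞 Kcm)})
    (φ : Isogeny (W.baseChange Kcm) (W.baseChange Kcm)) (hφ : ∀ P, φ (φ P) = (-7 : ℤ) • P) :
    Nonempty (KummerColumnDataRat W Kcm h2 K IK ι₀ 𝔣 d φ) := by
  obtain ⟨W₂, hW₂, hmin, hcs, φ₀, ψ₀, e, u, γ₂, hf, ψ, Ω, 𝔏, euK, hjW₂, hψφ, hφψ, he, hu, -, hβα, he₁, hψ, hLW, hψf, hpsiK, hΩ,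
      hlin, hcol⟩ :=
    KummerColumnLin.exists_kummerColumn_withPsiK_rat h159'' hE h25 h24i hM1 hM1' hG hC hbad hodd Kcm h2 s hs c hc ι₀ hι₀ K hK IK 𝔣
      h𝔣N h𝔣dvd φ hφ
  haveI := hW₂; haveI := hmin; haveI := hcs
  -- Skolemise the (Z3c) clause at `(φ′, m) := (φ, −7)`
  obtain ⟨μ, hμ, hlinφ⟩ := hlin φ (-7) hφ
  have hμ' : μ ^ 2 = (-7 : Kcm) := by exact_mod_cast hμ
  exact ⟨
    { W₂ := W₂, j_W₂ := hjW₂, isIsogenous := ⟨φ₀⟩, α := ψ₀.extendScalars Kcm, β := φ₀.extendScalars Kcm, e := e, βα := hβα,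
      e_eq := he, γ₂ := γ₂, hf := hf, good := he₁, ψ := ψ, ψ_infinityType := hψ, ψ_LSeries := hLW, ψ_conductor := hψf, Ω := Ω,
      Ω_ne_zero := hΩ, 𝔏 := 𝔏, euK := euK, column := hcol, psiK := hpsiK, μ := μ, μ_sq := hμ', lin := hlinφ,
      φ₀ := φ₀, ψ₀ := ψ₀, α_eq := rfl, β_eq := rfl, ψφ := hψφ, φψ := hφψ, u := u, u_eq := hu }⟩

/-! ## §3 The selector (same explicit argument list as `kummerColumnDataLinOf`) -/

section Constructor

variable -- the block of `PinnedKatoGenusFrameOfRecordLin` §3 VERBATIM (all named facts are EXISTING tree declarations; nothing asserted)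
  (hstar : exists_zetaClassPosition_of_rank_le_one) (hGZK : rank_eq_analyticRank_of_analyticRank_le_one)
  (h159'' : CM.prop159_kummerCup_expStar_values_linear)
  (hE : Literature.NumberTheory.ComplexMultiplication.EllipticUnits.Kato2004.sec155_exists_katoUnitRep)
  (h25 : DeShalit1987.prop25_i_normRelation) (h24i : DeShalit1987.prop24_i_mem_rayClassField)
  (hM1 : CM.rayClassField_le_torsionField) (hM1' : CM.torsionField_le_rayClassField_of_conductor)
  (hG : Gross_conductorExponent_baseChange_eq_two_mul) (h155u : Kato2004.kato155_isUnit_of_two_le_primeDivisors)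
  {W : WeierstrassCurve ℚ} [W.IsElliptic] [W.IsGloballyMinimal] [Fact (Nat.Prime 7)] (hC : X12.ClassCSeven W)
  [ContinuousSMul ℤ_[7] (W.tateModule 7)] (K : ZpExtension ℚ 7) (hK : K.IsCyclotomic)
  {γ : absoluteGaloisGroup ℚ} (hγ : K.IsTopGenerator γ) (I : IwasawaH1Data W 7 K γ)
  (F : GenusFrame) (hbad : ∀ (q : ℕ) [Fact q.Prime], q ≠ 7 → (¬ Good W q ↔ q ∣ F.d))
  (Kcm : Type) [Field Kcm] [NumberField Kcm] (h2 : Module.finrank ℚ Kcm = 2) (s : 𝓞 Kcm) (hs : (s : Kcm) ^ 2 = -7)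
  (c : Kcm ≃ₐ[ℚ] Kcm) (hc : c ≠ 1) (ι₀ : Kcm →+* ℂ) (hι₀ : ∀ (w : InfinitePlace Kcm) (x : Kcm), ι₀ x = w.embedding x)
  (e : AlgebraicClosure Kcm →+* AlgebraicClosure ℚ)
  [ContinuousSMul ℤ_[7] ((W.baseChange Kcm).tateModule 7)]
  (γK : absoluteGaloisGroup Kcm) (hγK : (K.restrictOfFinrankEqTwo (by decide) Kcm h2).IsTopGenerator γK)
  (IK : IwasawaH1DataOver (W.baseChange Kcm) 7 (K.restrictOfFinrankEqTwo (by decide) Kcm h2) γK)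
  (φ : Isogeny (W.baseChange Kcm) (W.baseChange Kcm)) (hφ : ∀ P, φ (φ P) = (-7 : ℤ) • P)

/-- **The selector of the THRICE-EXTENDED record at the constructor's inputs** (`d := F.d`, `𝔣 := (s)·(|D|)`), from `h159″`; explicit
arguments `h159'' hE h25 h24i hM1 hM1' hG hC K hK F hbad Kcm h2 s hs c hc ι₀ hι₀ γK IK φ hφ` = those of `kummerColumnDataLinOf`.
[cite: Kato2004Asterisque, (15.6.1) (p. 253) and 15.14 (p. 264)] [cite: SilvermanAEC2009, Thm. III.6.1 (a)] -/
def kummerColumnDataRatOf : KummerColumnDataRat W Kcm h2 K IK ι₀ (Ideal.span {s} * Ideal.span {((F.d : ℕ) : 𝓞 Kcm)}) F.d φ :=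
  Classical.choice (nonempty_kummerColumnDataRat h159'' hE h25 h24i hM1 hM1' hG hC hbad F.odd_d Kcm h2 (s : Kcm) hs c hc ι₀ hι₀ K hK IK
    (Ideal.span {s} * Ideal.span {((F.d : ℕ) : 𝓞 Kcm)}) (absNorm_span_sqrt_mul_span_natCast h2 s hs F.d)
    (span_sqrt_mul_span_natCast_dvd_span_seven_mul s hs F.d) φ hφ)

end Constructor

/-! ## §4 The transport pins FED BY THE RECORD, and (T4) `res₂ = res` on the nose -/

namespace PartnerTransport

variable {W W₂ : WeierstrassCurve ℚ} [W.IsElliptic] [W₂.IsElliptic] {p : ℕ} [Fact p.Prime]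
  [ContinuousSMul ℤ_[p] (W.tateModule p)] [ContinuousSMul ℤ_[p] (W₂.tateModule p)]
  {L : Type} [Field L] [NumberField L]
  [ContinuousSMul ℤ_[p] ((W.baseChange L).tateModule p)] [ContinuousSMul ℤ_[p] ((W₂.baseChange L).tateModule p)]
  {κ : ZpExtension ℚ p} {h : Function.Surjective (κ.toContinuousMonoidHom.comp (absGaloisRestrict ℚ L))}
  {γ : absoluteGaloisGroup ℚ} {γL : absoluteGaloisGroup L}

/-- (T4) **in VARIABLE form for the `L`-pair**: if `α = ψ₀.extendScalars L` and `β = φ₀.extendScalars L` then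
`(transportQ I φ₀ ψ₀ …).resOver (transport IL β α …) = I.resOver IL` — `resOver_transportQ_transport` after `subst`.  This is the form a
RECORD (whose `α, β` are fields pinned by equations) consumes. [cite: Rubin2000, App. B §3] [cite: Kato2004Asterisque, §12.2 (p. 220)] -/
theorem resOver_transportQ_transport_of_eq (hγ : κ.IsTopGenerator γ) (hγL : (κ.restrict L h).IsTopGenerator γL)
    (I : IwasawaH1Data W p κ γ) (IL : IwasawaH1DataOver (W.baseChange L) p (κ.restrict L h) γL)
    (φ₀ : Isogeny W W₂) (ψ₀ : Isogeny W₂ W)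
    (α : Isogeny (W₂.baseChange L) (W.baseChange L)) (β : Isogeny (W.baseChange L) (W₂.baseChange L))
    (hα : α = ψ₀.extendScalars L) (hβ : β = φ₀.extendScalars L)
    (e : ℤ) (u : ℤ_[p]ˣ) (hu : (u : ℤ_[p]) = e) (hψφ : ∀ P, ψ₀ (φ₀ P) = e • P) (hφψ : ∀ Q, φ₀ (ψ₀ Q) = e • Q)
    (hαβ : ∀ P, α (β P) = e • P) (hβα : ∀ Q, β (α Q) = e • Q) (y : I.H) :
    (transportQ I φ₀ ψ₀ e u hu hψφ hφψ).resOver (transport IL β α e u hu hαβ hβα) hγ hγL y = I.resOver IL hγ hγL y := by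
  subst hα hβ
  exact resOver_transportQ_transport hγ hγL I IL φ₀ ψ₀ e u hu hψφ hφψ hαβ hβα y

end PartnerTransport

namespace KummerColumnDataRat

variable {W : WeierstrassCurve ℚ} [W.IsElliptic] [Fact (Nat.Prime 7)]
  {Kcm : Type} [Field Kcm] [NumberField Kcm] {h2 : Module.finrank ℚ Kcm = 2}
  [ContinuousSMul ℤ_[7] ((W.baseChange Kcm).tateModule 7)]
  {K : ZpExtension ℚ 7} {γK : absoluteGaloisGroup Kcm}
  {IK : IwasawaH1DataOver (W.baseChange Kcm) 7 (K.restrictOfFinrankEqTwo (by decide) Kcm h2) γK}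
  {ι₀ : Kcm →+* ℂ} {𝔣 : Ideal (𝓞 Kcm)} {d : ℕ}
  {φ : Isogeny (W.baseChange Kcm) (W.baseChange Kcm)}
  (D : KummerColumnDataRat W Kcm h2 K IK ι₀ 𝔣 d φ)

/-- **The partner's `K`-side pin FED BY THE RECORD**: `PartnerTransport.transport IK′ D.β D.α D.e D.u …` — the pin of `W₂_K` on the carrier of a
`K`-side pin `IK′` of the member (any `IK′` over the record's tower; at the frame `IK′ := Φ.IK = IK`). [cite: Kato2004Asterisque, §12.2 (p. 220) and Ex. 13.3 (p. 225)] -/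
def transportIK (IK' : IwasawaH1DataOver (W.baseChange Kcm) 7 (K.restrictOfFinrankEqTwo (by decide) Kcm h2) γK) :
    letI := D.isElliptic_W₂
    letI := D.continuousSMul_W₂
    IwasawaH1DataOver (D.W₂.baseChange Kcm) 7 (K.restrictOfFinrankEqTwo (by decide) Kcm h2) γK :=
  letI := D.isElliptic_W₂
  letI := D.continuousSMul_W₂
  PartnerTransport.transport IK' D.β D.α D.e D.u D.u_eq D.αβ D.βα

/-- **The partner's `ℚ`-side pin FED BY THE RECORD**: `PartnerTransport.transportQ I D.φ₀ D.ψ₀ D.e D.u …` on the carrier `I.H`.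
[cite: Kato2004Asterisque, §12.2 (p. 220) and Ex. 13.3 (p. 225)] -/
def transportI [ContinuousSMul ℤ_[7] (W.tateModule 7)] {γ : absoluteGaloisGroup ℚ} (I : IwasawaH1Data W 7 K γ) :
    letI := D.isElliptic_W₂
    haveI : ContinuousSMul ℤ_[7] (D.W₂.tateModule 7) := TateModule.continuousSMul_padicInt
    IwasawaH1Data D.W₂ 7 K γ :=
  letI := D.isElliptic_W₂
  haveI : ContinuousSMul ℤ_[7] (D.W₂.tateModule 7) := TateModule.continuousSMul_padicInt
  PartnerTransport.transportQ I D.φ₀ D.ψ₀ D.e D.u D.u_eq D.ψφ D.φψ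

/-- The layers of the record-fed `K`-side partner pin are `β_* ∘ IK′.proj n`. [cite: Kato2004Asterisque, §12.2 (p. 220)] -/
theorem transportIK_proj (IK' : IwasawaH1DataOver (W.baseChange Kcm) 7 (K.restrictOfFinrankEqTwo (by decide) Kcm h2) γK) (n : ℕ) (x : IK'.H) :
    letI := D.isElliptic_W₂
    letI := D.continuousSMul_W₂
    (D.transportIK IK').proj n x = isogenyLayerMapK 7 D.β ((K.restrictOfFinrankEqTwo (by decide) Kcm h2).layerSubgroup n) (IK'.proj n x) :=
  rfl

/-- The layers of the record-fed `ℚ`-side partner pin are `(φ₀)_* ∘ I.proj n`. [cite: Kato2004Asterisque, §12.2 (p. 220)] -/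
theorem transportI_proj [ContinuousSMul ℤ_[7] (W.tateModule 7)] {γ : absoluteGaloisGroup ℚ} (I : IwasawaH1Data W 7 K γ) (n : ℕ) (x : I.H) :
    letI := D.isElliptic_W₂
    haveI : ContinuousSMul ℤ_[7] (D.W₂.tateModule 7) := TateModule.continuousSMul_padicInt
    (D.transportI I).proj n x = isogenyMapH1 7 D.φ₀ (K.layerSubgroup n) (I.proj n x) :=
  rfl

/-- ★ (T4) **`res₂ = res` ON THE NOSE for the record-fed pins**: `(D.transportI I).resOver (D.transportIK IK′) hγ hγK y = I.resOver IK′ hγ hγK y`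
— `PartnerTransport.resOver_transportQ_transport` through `α_eq`, `β_eq`. [cite: Rubin2000, App. B §3] [cite: Kato2004Asterisque, §12.2 (p. 220)] -/
theorem resOver_transportI_transportIK [ContinuousSMul ℤ_[7] (W.tateModule 7)] {γ : absoluteGaloisGroup ℚ}
    (hγ : K.IsTopGenerator γ) (hγK : (K.restrictOfFinrankEqTwo (by decide) Kcm h2).IsTopGenerator γK)
    (I : IwasawaH1Data W 7 K γ) (IK' : IwasawaH1DataOver (W.baseChange Kcm) 7 (K.restrictOfFinrankEqTwo (by decide) Kcm h2) γK)
    (y : I.H) :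
    letI := D.isElliptic_W₂
    letI := D.continuousSMul_W₂
    haveI : ContinuousSMul ℤ_[7] (D.W₂.tateModule 7) := TateModule.continuousSMul_padicInt
    (D.transportI I).resOver (D.transportIK IK') hγ hγK y = I.resOver IK' hγ hγK y := by
  letI := D.isElliptic_W₂
  letI := D.continuousSMul_W₂
  haveI : ContinuousSMul ℤ_[7] (D.W₂.tateModule 7) := TateModule.continuousSMul_padicInt
  exact PartnerTransport.resOver_transportQ_transport_of_eq hγ hγK I IK' D.φ₀ D.ψ₀ D.α D.β D.α_eq D.β_eq D.e D.u D.u_eq D.ψφ D.φψ D.αβ D.βα y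

end KummerColumnDataRat

end Summit.BirchSwinnertonDyer.Rank1Residual.Additive.GenusSeven

end
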